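import Summits.Ventures.HSemireg.UntwistCocycleTwistJetHigher
import HarnessLib

/-!
# Venture HSemireg — route R1.0, untwisted reading, rows `q ≥ 2` input (L0): **`ι′ = ι⟨c⟩ ≫ λ_0`** — the
# identification `E⟨c⟩ → E⟨c⟩ ⊗ Ω⁰` is the twist of `E → E ⊗ Ω⁰` followed by the comparison `λ_{Ω⁰}`
# (gs-g4; `general-structure/LEIBNIZ-ROW2-PLAN-gs-g4.md` §5 (L0))

HONEST FRAMING. Module-level algebra on the tree's REAL carriers (`toTwistHodgeZero` of
`HodgeTheory/SemiregularityHigherSigma.lean`, th-4's cocycle twist `E⟨c⟩ = twist c E`, `twistMap`, and the comparison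
`λ_G = dualHomTwist c E G` of `UntwistCocycleTwistDualHom.lean`). Nothing about any variety; no gerbe; nothing here says
HC, HC_CM or HC_AV is proved.

WHAT IS PROVED (no `def`).
* `twist_hom_ext` — two morphisms OUT of a twist `E⟨c⟩ → N` agree as soon as they agree on the local sections
  `e ⊗ t_x` (sheaf property of `N`; every section of `E⟨c⟩` over `V ⊆ U_x` is `e_x ⊗ t_x`);
* `twistMap_toBidual_comp_dualHomTwist` — **`(E → E^∨∨)⟨c⟩ ≫ λ_{𝒪} = (E⟨c⟩ → (E⟨c⟩)^∨∨)`**: biduality commutes with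
  the twist through `λ` (`λ_𝒪((μ ↦ μ(e)) ⊗ t_x) = (μ′ ↦ μ′(e ⊗ t_x))`);
* **`toTwistHodgeZero_twist`** — `ι′ = ι⟨c⟩ ≫ λ_{Ω⁰}` for `ι = toTwistHodgeZero E : E → E ⊗ Ω⁰`,
  `ι′ = toTwistHodgeZero (E⟨c⟩)` (biduality as above, then naturality of `λ` in the coefficients along `𝒪_X ≅ Ω⁰`,
  `twistMap_sheafHomMap_comp_dualHomTwist`);
* `mapExtAddHom_comp_mk₀_toTwistHodgeZero_twist` — the same on `Ext`: `θ(y) · [ι′] = θ(y · [ι]) · [λ_{Ω⁰}]` for every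
  `y ∈ Extⁿ(A, E)` — the entry point `θx · ι′` of `σ_q^{E⟨c⟩}(θ x) = Tr(θx · ι′ · at′_0 ⋯ at′_{q-1})`.

Which objects: `E⟨c⟩`, `E ⊗ Ω⁰ = 𝓗om(E^∨, Ω⁰)`, `(E ⊗ Ω⁰)⟨c⟩`, `E⟨c⟩ ⊗ Ω⁰`; which twist: `- ⊗ M_B`.

## References

* R. Hartshorne, *Algebraic Geometry* (1977), II Ex. 5.1 (a), (b) (biduality, `𝓗om(E^∨, G) ≅ E ⊗ G`). [Hartshorne1977]
* The Stacks project, Tag 01CM (tensoring with an invertible module). [StacksProject]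
-/

noncomputable section

open CategoryTheory CategoryTheory.Abelian AlgebraicGeometry Opposite TopologicalSpace Limits

namespace Summit.Ventures.HSemireg

namespace CocycleTwist

open Literature.AlgebraicGeometry.Modules Literature.AlgebraicGeometry.Motives
  Literature.AlgebraicGeometry.HodgeTheory

universe u

section Sheaf

variable {S : Type u} [CommRing S] {X : Over (Spec (CommRingCat.of S))} (c : UnitCocycle X.left) (E : X.left.Modules)

/-- **Locality for morphisms out of a twist**: `φ, ψ : E⟨c⟩ → N` agree if they agree on all local sections `e ⊗ t_x`
(`V ⊆ U_x`, `e ∈ Γ(E, V)`): every section of `E⟨c⟩` is locally of this form (`trivSection_coordAt`) and `N` is a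
sheaf. [folklore] -/
theorem twist_hom_ext {N : X.left.Modules} {φ ψ : twist c E ⟶ N}
    (h : ∀ (x : X.left) (V : X.left.Opens) (hV : V ≤ c.U x) (e : Γ(E, V)),
      φ.app V (trivSection c E x hV e) = ψ.app V (trivSection c E x hV e)) : φ = ψ := by
  refine Scheme.Modules.hom_ext _ _ fun V => AddCommGrpCat.ext fun (s : Γ(twist c E, V)) => ?_
  refine TopCat.Sheaf.eq_of_locally_eq' ((SheafOfModules.toSheaf _).obj N) (fun x : X.left => V ⊓ c.U x) V
    (fun x => homOfLE inf_le_left) (fun y hy => Opens.mem_iSup.2 ⟨y, hy, c.mem y⟩) _ _ fun x => ?_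
  change N.presheaf.map (homOfLE (inf_le_left : V ⊓ c.U x ≤ V)).op (φ.app V s) =
    N.presheaf.map (homOfLE (inf_le_left : V ⊓ c.U x ≤ V)).op (ψ.app V s)
  rw [← Scheme.Modules.Hom.app_map_apply, ← Scheme.Modules.Hom.app_map_apply,
    ← trivSection_coordAt c E x inf_le_right
      ((twist c E).presheaf.map (homOfLE (inf_le_left : V ⊓ c.U x ≤ V)).op s)]
  exact h x _ inf_le_right _

/-- **Biduality commutes with the twist through `λ`**: `(E → E^∨∨)⟨c⟩ ≫ λ_{𝒪_X} = (E⟨c⟩ → (E⟨c⟩)^∨∨)` — on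
`e ⊗ t_x` both sides are the functional `μ ↦ μ(e ⊗ t_x)` on `(E⟨c⟩)^∨` (over `U_y`: `g_{yx} · μ(e ⊗ t_y)`,
`e ⊗ t_x = g_{yx} e ⊗ t_y`). [cite: Hartshorne1977, II Ex. 5.1 (a)] -/
theorem twistMap_toBidual_comp_dualHomTwist :
    twistMap c (toBidual E (unitModule X.left)) ≫ dualHomTwist c E (unitModule X.left) =
      toBidual (twist c E) (unitModule X.left) := by
  refine twist_hom_ext c E fun x V hV e => ?_
  rw [Scheme.Modules.Hom.comp_app, CategoryTheory.comp_apply, twistMap_app_trivSection, toBidual_app_apply,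
    toBidual_app_apply]
  refine hom_ext_of_appLE_le c fun y W l hy (μ : (twist c E).over W ⟶ (unitModule X.left).over W) => ?_
  rw [appLE_dualHomTwist_trivSection c E x y hV l hy, appLE_evalAt, appLE_evalAt, appLE_comp, appLE_toTwistOver,
    trivSection_map, trivSection_eq_trivSection_smul c E x y (l.le.trans hV) hy, trivSection_smul, appLE_smul_right]

end Sheaf

section Hodge

variable {S : Type u} [CommRing S] {X : Over (Spec (CommRingCat.of S))} (c : UnitCocycle X.left) (E : X.left.Modules)

/-- **`ι′ = ι⟨c⟩ ≫ λ_{Ω⁰}`**: the identification `E⟨c⟩ → E⟨c⟩ ⊗ Ω⁰ = 𝓗om((E⟨c⟩)^∨, Ω⁰)` (biduality, then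
`𝒪_X ≅ Ω⁰`) is the twist of `ι : E → E ⊗ Ω⁰` followed by the comparison `λ_{Ω⁰} : (E ⊗ Ω⁰)⟨c⟩ → E⟨c⟩ ⊗ Ω⁰`.
[cite: Hartshorne1977, II Ex. 5.1 (a), (b)] -/
theorem toTwistHodgeZero_twist :
    toTwistHodgeZero (twist c E) = twistMap c (toTwistHodgeZero E) ≫ dualHomTwist c E (hodgeSheaf X 0) := by
  rw [toTwistHodgeZero, toTwistHodgeZero, twistMap_comp, Category.assoc, twistMap_sheafHomMap_comp_dualHomTwist,
    ← Category.assoc, twistMap_toBidual_comp_dualHomTwist]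

variable [HasExt.{u + 1} X.left.Modules]

/-- **`θ(y) · [ι′] = θ(y · [ι]) · [λ_{Ω⁰}]` in `Extⁿ(A⟨c⟩, E⟨c⟩ ⊗ Ω⁰)`** for every `y ∈ Extⁿ(A, E)` (`θ = - ⊗ M` on
`Ext`): the entry point `θx · ι′` of `σ_q^{E⟨c⟩}(θ x)`. [folklore] -/
theorem mapExtAddHom_comp_mk₀_toTwistHodgeZero_twist {A : X.left.Modules} {n : ℕ} (y : Ext.{u + 1} A E n) :
    ((twistEquivalence X.left c).functor.mapExtAddHom A E n y).comp (Ext.mk₀ (toTwistHodgeZero (twist c E)))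
        (add_zero n) =
      ((twistEquivalence X.left c).functor.mapExtAddHom A (twistHodge E 0) n
          (y.comp (Ext.mk₀ (toTwistHodgeZero E)) (add_zero n))).comp
        (Ext.mk₀ (dualHomTwistObj c E (hodgeSheaf X 0))) (add_zero n) := by
  rw [Functor.mapExtAddHom_apply, Functor.mapExtAddHom_apply, Ext.mapExactFunctor_comp, Ext.mapExactFunctor_mk₀,
    Ext.comp_assoc_of_third_deg_zero, Ext.mk₀_comp_mk₀, toTwistHodgeZero_twist]
  rfl

end Hodge

end CocycleTwist

end Summit.Ventures.HSemireg

end
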